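import Literature.AlgebraicGeometry.Motives.ComplexPointsSubmersion
import Mathlib.Analysis.Calculus.InverseFunctionTheorem.FDeriv
import Mathlib.Analysis.Calculus.ContDiff.RCLike
import Mathlib.Topology.IsLocalHomeomorph
import HarnessLib

/-!
# `f(ℂ)` is a local homeomorphism for `f` smooth of relative dimension `0` (étale)

For `ℂ`-schemes `X`, `Y` locally of finite type and smooth of the same relative dimension `n`, and a
`ℂ`-morphism `f : X ⟶ Y` with `f` smooth (hence étale: smooth of relative dimension `0`), the map of
complex points `f(ℂ) : X(ℂ) → Y(ℂ)` is a LOCAL HOMEOMORPHISM for the analytic topologies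
(`ComplexPoints.isLocalHomeomorph_map`): SGA 1, Exp. XII, Prop. 3.1 (iii) («`f` étale ⇔ `f^an`
étale», i.e. a local isomorphism of analytic spaces); Serre, GAGA §2 n°5. Proof: in the algebraic
charts of `Motives/ComplexPointsSubmersion` the chart expression `G = e_Y ∘ f(ℂ) ∘ e_X⁻¹ : ℂⁿ → ℂⁿ`
is holomorphic (`contDiffOn_chart_map`) with onto, hence bijective, complex Jacobian
(`surjective_fderiv_chart_map`), so the holomorphic inverse function theorem (Mathlib
`HasStrictFDerivAt.toOpenPartialHomeomorph`) makes `G`, and with it `f(ℂ)`, a homeomorphism near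
every point. This is the local model of a finite projection at an unramified point used by the
moving lemma at the level of classes.

## References
* [SGA1] A. Grothendieck, M. Raynaud, SGA 1, Exp. XII, Prop. 3.1 (iii), Thm. 1.1.
* [SerreGAGA1956] J.-P. Serre, GAGA, Ann. Inst. Fourier 6 (1956), §2 n°5.

#harness_tags algebraic_geometry.gaga, topology.local_homeomorphism
-/

noncomputable section

open CategoryTheory AlgebraicGeometry Filter Topology Set
open scoped ContDiff Manifold

namespace Literature.AlgebraicGeometry.Motives

namespace ComplexPoints

variable {X Y : SchemeOver ℂ} [LocallyOfFiniteType X.hom] [LocallyOfFiniteType Y.hom]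

/-- **`f(ℂ)` is a local homeomorphism at every point for `f` smooth between smooth `ℂ`-schemes of
the same dimension**: there is a partial homeomorphism `X(ℂ) ⇀ Y(ℂ)` with source containing `P`
agreeing with `f(ℂ)` on its source. [cite: SGA1, Exp. XII Prop. 3.1 (iii)] [cite: SerreGAGA1956, §2 n°5 (p. 9)] -/
theorem exists_openPartialHomeomorph_eqOn_map (n : ℕ) [SmoothOfRelativeDimension n X.hom]
    [SmoothOfRelativeDimension n Y.hom] (f : X ⟶ Y) [Smooth f.left] (P : ComplexPoints X) :
    ∃ e : OpenPartialHomeomorph (ComplexPoints X) (ComplexPoints Y), P ∈ e.source ∧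
      EqOn (AlgPoints.map f) e e.source := by
  classical
  set Q := AlgPoints.map f P with hQdef
  set aX := algebraicChart X n P with haX
  set aY := algebraicChart Y n Q with haY
  obtain ⟨⟨V₁, u, hsrcY, hu⟩, holY⟩ := algebraicChart_spec Y n Q
  obtain ⟨algX, holX⟩ := algebraicChart_spec X n P
  have hP : P ∈ aX.source := mem_algebraicChart_source X n P
  have hQ : Q ∈ aY.source := mem_algebraicChart_source Y n Q
  have hQV₁ : Q.pt ∈ (↑V₁ : Y.left.Opens) := hsrcY hQ
  obtain ⟨U, hPU, hle, t, htspan⟩ :=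
    exists_localCoordinates_le n P (f.left ⁻¹ᵁ ↑V₁) (show P.pt ∈ f.left ⁻¹ᵁ ↑V₁ from hQV₁)
  obtain ⟨hdiff, hsurj⟩ := surjective_fderiv_chart_map f aX hP holX algX aY hQ holY V₁ u hsrcY hu
    U hPU hle t htspan
  -- the holomorphic chart expression `G` with bijective Jacobian `G'`
  set G : (Fin n → ℂ) → (Fin n → ℂ) := aY ∘ AlgPoints.map f ∘ aX.symm with hGdef
  set G' : (Fin n → ℂ) →L[ℂ] (Fin n → ℂ) := fderiv ℂ G (aX P) with hG'
  have hbij : Function.Bijective G' :=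
    ⟨LinearMap.injective_iff_surjective.2 hsurj, hsurj⟩
  set E : (Fin n → ℂ) ≃L[ℂ] (Fin n → ℂ) :=
    (LinearEquiv.ofBijective (G' : (Fin n → ℂ) →ₗ[ℂ] (Fin n → ℂ)) hbij).toContinuousLinearEquiv with hE
  have hEG' : (E : (Fin n → ℂ) →L[ℂ] (Fin n → ℂ)) = G' := by
    ext v
    rfl
  -- `G` is holomorphic near `aX P`, hence strictly differentiable there
  set O : Set (Fin n → ℂ) := aX.target ∩ aX.symm ⁻¹' (AlgPoints.map f ⁻¹' aY.source) with hO
  have hOopen : IsOpen O :=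
    aX.isOpen_inter_preimage_symm ((aY.open_source).preimage (AlgPoints.continuous_map f))
  have hPO : aX P ∈ O := by
    refine ⟨aX.map_source hP, ?_⟩
    change AlgPoints.map f (aX.symm (aX P)) ∈ aY.source
    rw [aX.left_inv hP]
    exact hQ
  have hGhol : ContDiffOn ℂ ω G O := contDiffOn_chart_map (n := n) (m := n) f P Q
  have hGat : ContDiffAt ℂ ω G (aX P) := hGhol.contDiffAt (hOopen.mem_nhds hPO)
  have hstrict : HasStrictFDerivAt G (E : (Fin n → ℂ) →L[ℂ] (Fin n → ℂ)) (aX P) := by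
    rw [hEG']
    exact hGat.hasStrictFDerivAt (by simp)
  -- the local inverse of `G`, conjugated back by the charts
  set eG := hstrict.toOpenPartialHomeomorph G with heG
  have heGsrc : aX P ∈ eG.source := hstrict.mem_toOpenPartialHomeomorph_source
  have heGcoe : (eG : (Fin n → ℂ) → (Fin n → ℂ)) = G := hstrict.toOpenPartialHomeomorph_coe
  set aX' := aX.restrOpen (AlgPoints.map f ⁻¹' aY.source)
    ((aY.open_source).preimage (AlgPoints.continuous_map f)) with haX'
  refine ⟨(aX'.trans eG).trans aY.symm, ?_, ?_⟩
  · simp only [OpenPartialHomeomorph.trans_source, OpenPartialHomeomorph.symm_source, mem_inter_iff,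
      mem_preimage, OpenPartialHomeomorph.coe_trans, Function.comp_apply, haX',
      OpenPartialHomeomorph.restrOpen_source]
    refine ⟨⟨⟨hP, hQ⟩, ?_⟩, ?_⟩
    · exact heGsrc
    · change eG (aX P) ∈ aY.target
      rw [heGcoe]
      change aY (AlgPoints.map f (aX.symm (aX P))) ∈ aY.target
      rw [aX.left_inv hP]
      exact aY.map_source hQ
  · intro y hy
    simp only [OpenPartialHomeomorph.trans_source, OpenPartialHomeomorph.symm_source, mem_inter_iff,
      mem_preimage, haX', OpenPartialHomeomorph.restrOpen_source] at hy
    obtain ⟨⟨⟨hy1, hy2⟩, -⟩, -⟩ := hy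
    change AlgPoints.map f y = aY.symm (eG (aX y))
    rw [heGcoe]
    change AlgPoints.map f y = aY.symm (aY (AlgPoints.map f (aX.symm (aX y))))
    rw [aX.left_inv hy1, aY.left_inv hy2]

/-- **`f(ℂ) : X(ℂ) → Y(ℂ)` is a local homeomorphism** for `f : X ⟶ Y` smooth between
`ℂ`-schemes locally of finite type and smooth of the same relative dimension `n` (`f` is then
étale; SGA 1 XII Prop. 3.1 (iii): `f` étale ⇔ `f^an` a local isomorphism).
[cite: SGA1, Exp. XII Prop. 3.1 (iii)] -/
theorem isLocalHomeomorph_map (n : ℕ) [SmoothOfRelativeDimension n X.hom]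
    [SmoothOfRelativeDimension n Y.hom] (f : X ⟶ Y) [Smooth f.left] :
    IsLocalHomeomorph (AlgPoints.map f : ComplexPoints X → ComplexPoints Y) :=
  IsLocalHomeomorph.mk (AlgPoints.map f) fun P ↦ exists_openPartialHomeomorph_eqOn_map n f P

/-- `f(ℂ)` is an open map for `f` étale between smooth `ℂ`-schemes of the same dimension.
[cite: SGA1, Exp. XII Prop. 3.1 (iii)] -/
theorem isOpenMap_map (n : ℕ) [SmoothOfRelativeDimension n X.hom]
    [SmoothOfRelativeDimension n Y.hom] (f : X ⟶ Y) [Smooth f.left] :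
    IsOpenMap (AlgPoints.map f : ComplexPoints X → ComplexPoints Y) :=
  (isLocalHomeomorph_map n f).isOpenMap

/-- `f(ℂ)` is locally injective for `f` étale between smooth `ℂ`-schemes of the same dimension.
[cite: SGA1, Exp. XII Prop. 3.1 (iii)] -/
theorem isLocallyInjective_map (n : ℕ) [SmoothOfRelativeDimension n X.hom]
    [SmoothOfRelativeDimension n Y.hom] (f : X ⟶ Y) [Smooth f.left] :
    IsLocallyInjective (AlgPoints.map f : ComplexPoints X → ComplexPoints Y) :=
  (isLocalHomeomorph_map n f).isLocallyInjective

end ComplexPoints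

end Literature.AlgebraicGeometry.Motives
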